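import Mathlib
import Summits.Ventures.HSemireg.TwoAdicLineRule

/-!
# LINE LAW — even weights of one reached line share their 2-adic valuation (ENGINE-W code B, #B19)

PROPOSITION 2 of the LINE LAW (the 2-ADIC RULE; kernel `TwoAdicLineRule`, k = 295) says that on a line reached at `(T, A)` all
EVEN quotients `T ∕ c` have the same 2-adic valuation `e = v₂(A² − m)`.  Together with LEMMA P (i) (`T ∣ A² − m` whenever the
weights have no common divisor; kernel #B16 `LineLawPrincipalProper.winding_dvd_of_bezout`) this has a consequence at the level
of the WEIGHTS themselves, used silently in every census table and named by REF-W ROW 363 rider P-S1K-2 («the 26 census sets with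
two even weights of distinct `v₂` are dead on every `m`»):
* `even_weights_same_two_adic_part` — if two EVEN weights `c, c'` lie on one line reached at `(T, A)` with `T ∣ A² − m`, `T ≠ 0`,
  then `c · u = c' · u'` for some ODD `u, u'` (i.e. `v₂(c) = v₂(c')`).  Proof: write the data `z w = z' w' = A − l`,
  `T = c · N z = c' · N z'`; if `N z`, `N z'` are both odd take `u = N z`, `u' = N z'`; if both are even, the cofactor norms
  `N w`, `N w'` are odd (PROP. 2) and `c · N w' = c' · N w` (cancel `T` in `c c' (A² − m)`); if `N z` is even and `N z'` odd then
  `T q = A² − m = N z · N w` gives `N w = c q`, even — contradicting PROP. 2 (so this case does not occur for an even `c`).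
* `no_line_two_even_weights_of_ne_val` — hence weights `c = 2^a · (odd)`, `c' = 2^b · (odd)` with `a ≠ b`, `a, b ≥ 1` never lie
  on one reached line with `T ∣ A² − m` — so, by LEMMA P (i), on no line whose weights have no common divisor (e.g. the sets
  `{2, 4, k}`, `{2, 8, k}`, `{4, 6, k}`, `{6, 8, k}` with `k` ODD, on every `m`; for an even `k` the set has a common factor `2`
  and reduces to `{1, 2, k∕2}` etc. at `T∕2`, which may well be reached);
* `weight_odd_of_even_norm` — the mixed case as a lemma: a datum with `N z` even and `T q = A² − m` has `c · q = N w` (odd),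
  so its weight `c` is odd; `weights_two_adic_bookkeeping` — the two surviving cases without parity hypotheses on the weights.
Honest framing: integer ∕ `ℤ√m` arithmetic only, any integer `m`; THEOREM CF⁶ by value; Mukai vectors and lattices elsewhere, not
objects; nothing here says that HC, HC_CM or HC_AV holds.
-/

namespace Summit.Ventures.HSemireg.LineLawEvenWeights

open Zsqrtd
open Summit.Ventures.HSemireg.TwoAdicLineRule (odd_norm_cofactor norm_A_sub_l)

/-- On a datum `z · w = A − l` with `T = c · N z` and `T ∣ A² − m`: if `N z` is EVEN then the weight times the quotient
`(A² − m) ∕ T` is the (odd) cofactor norm, `c · q = N w`; in particular `c` is odd.  (The mixed case of the proof.) -/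
theorem weight_odd_of_even_norm {m A T c q : ℤ} {z w : ℤ√m} (h : z * w = ⟨A, -1⟩) (hT : T = c * z.norm)
    (hq : T * q = A * A - m) (hn : z.norm ≠ 0) (heven : Even z.norm) : c * q = w.norm ∧ Odd c := by
  have hcop : IsCoprime z.re z.im := by
    have him : z.re * w.im + z.im * w.re = -1 := by simpa [Zsqrtd.im_mul] using congrArg Zsqrtd.im h
    exact ⟨-w.im, -w.re, by linear_combination -him⟩
  have hodd : Odd w.norm := odd_norm_cofactor m A z w hcop heven h.symm
  have hD : A * A - m = z.norm * w.norm := by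
    have := norm_A_sub_l m A; rw [← h, Zsqrtd.norm_mul] at this; linear_combination -this
  have hcq : c * q = w.norm := by
    apply mul_left_cancel₀ hn
    calc z.norm * (c * q) = T * q := by rw [hT]; ring
      _ = z.norm * w.norm := by rw [hq, hD]
  refine ⟨hcq, ?_⟩
  -- `c q` odd ⇒ `c` odd
  rw [← hcq] at hodd
  exact (Int.odd_mul.1 hodd).1

/-- **Even weights of one reached line share their 2-adic part.**  Two EVEN weights `c, c'` with data `z w = z' w' = A − l`,
`T = c · N z = c' · N z'`, `T ≠ 0`, `T ∣ A² − m` satisfy `c · u = c' · u'` for some odd `u, u'`. -/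
theorem even_weights_same_two_adic_part {m A T c c' : ℤ} {z w z' w' : ℤ√m} (h : z * w = ⟨A, -1⟩) (h' : z' * w' = ⟨A, -1⟩)
    (hT : T = c * z.norm) (hT' : T = c' * z'.norm) (hT0 : T ≠ 0) (hdiv : T ∣ A * A - m) (hc : Even c) (hc' : Even c') :
    ∃ u u' : ℤ, Odd u ∧ Odd u' ∧ c * u = c' * u' := by
  have hn : z.norm ≠ 0 := by intro h0; apply hT0; rw [hT, h0, mul_zero]
  have hn' : z'.norm ≠ 0 := by intro h0; apply hT0; rw [hT', h0, mul_zero]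
  obtain ⟨q, hq⟩ := hdiv
  rcases Int.even_or_odd z.norm with hev | hod
  · -- `N z` even: then `c` would be odd — excluded
    exact absurd (weight_odd_of_even_norm h hT hq.symm hn hev).2 (Int.not_odd_iff_even.2 hc)
  · rcases Int.even_or_odd z'.norm with hev' | hod'
    · exact absurd (weight_odd_of_even_norm h' hT' hq.symm hn' hev').2 (Int.not_odd_iff_even.2 hc')
    · exact ⟨z.norm, z'.norm, hod, hod', by rw [← hT, ← hT']⟩

/-- The same conclusion WITHOUT the parity hypothesis on the weights, in the two cases that occur: if both `N z`, `N z'` are odd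
then `c · N z = c' · N z'`; if both are even then `c · N w' = c' · N w` with `N w`, `N w'` odd (PROPOSITION 2). -/
theorem weights_two_adic_bookkeeping {m A T c c' : ℤ} {z w z' w' : ℤ√m} (h : z * w = ⟨A, -1⟩) (h' : z' * w' = ⟨A, -1⟩)
    (hT : T = c * z.norm) (hT' : T = c' * z'.norm) (hT0 : T ≠ 0) (hev : Even z.norm) (hev' : Even z'.norm) :
    c * w'.norm = c' * w.norm ∧ Odd w.norm ∧ Odd w'.norm := by
  have cop : ∀ {x y : ℤ√m}, x * y = ⟨A, -1⟩ → IsCoprime x.re x.im := by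
    intro x y hxy
    have him : x.re * y.im + x.im * y.re = -1 := by simpa [Zsqrtd.im_mul] using congrArg Zsqrtd.im hxy
    exact ⟨-y.im, -y.re, by linear_combination -him⟩
  have o1 : Odd w.norm := odd_norm_cofactor m A z w (cop h) hev h.symm
  have o2 : Odd w'.norm := odd_norm_cofactor m A z' w' (cop h') hev' h'.symm
  have d1 : A * A - m = z.norm * w.norm := by
    have := norm_A_sub_l m A; rw [← h, Zsqrtd.norm_mul] at this; linear_combination -this
  have d2 : A * A - m = z'.norm * w'.norm := by
    have := norm_A_sub_l m A; rw [← h', Zsqrtd.norm_mul] at this; linear_combination -this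
  refine ⟨?_, o1, o2⟩
  apply mul_left_cancel₀ hT0
  -- `T · (c · N w') = c c' (A² − m) = T · (c' · N w)`
  calc T * (c * w'.norm) = c * (c' * (z'.norm * w'.norm)) := by rw [hT']; ring
    _ = c * (c' * (z.norm * w.norm)) := by rw [← d2, d1]
    _ = T * (c' * w.norm) := by rw [hT]; ring

/-- **Two even weights of distinct 2-adic valuation never lie on one reached line with `T ∣ A² − m`** (the «PROP.-2-dead» sets
of the census — all of gcd `1`, so `T ∣ A² − m` holds by LEMMA P (i) — e.g. `{2, 4, k}`, `{4, 6, k}`, `{2, 8, k}` with `k` odd):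
if `c = 2^a · s`, `c' = 2^b · s'` with `s, s'` odd, `1 ≤ a`, `1 ≤ b`, `a ≠ b`, there is no datum with `T ≠ 0`, `T ∣ A² − m`. -/
theorem no_line_two_even_weights_of_ne_val {m A T s s' : ℤ} {a b : ℕ} {z w z' w' : ℤ√m} (h : z * w = ⟨A, -1⟩)
    (h' : z' * w' = ⟨A, -1⟩) (hT : T = (2 ^ a * s) * z.norm) (hT' : T = (2 ^ b * s') * z'.norm) (hT0 : T ≠ 0)
    (hdiv : T ∣ A * A - m) (hs : Odd s) (hs' : Odd s') (ha : 1 ≤ a) (hb : 1 ≤ b) (hab : a ≠ b) : False := by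
  have hc : Even ((2 : ℤ) ^ a * s) := by
    obtain ⟨a', rfl⟩ := Nat.exists_eq_add_of_le ha
    exact ⟨2 ^ a' * s, by ring⟩
  have hc' : Even ((2 : ℤ) ^ b * s') := by
    obtain ⟨b', rfl⟩ := Nat.exists_eq_add_of_le hb
    exact ⟨2 ^ b' * s', by ring⟩
  obtain ⟨u, u', hu, hu', e⟩ := even_weights_same_two_adic_part h h' hT hT' hT0 hdiv hc hc'
  -- `2^a · (s u) = 2^b · (s' u')` with `s u`, `s' u'` odd forces `a = b`
  have key : (2 : ℤ) ^ a * (s * u) = 2 ^ b * (s' * u') := by linear_combination e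
  have hsu : Odd (s * u) := hs.mul hu
  have hsu' : Odd (s' * u') := hs'.mul hu'
  -- compare 2-adic valuations via `emultiplicity`
  have v1 : emultiplicity (2 : ℤ) (2 ^ a * (s * u)) = a := by
    rw [emultiplicity_mul Int.prime_two, emultiplicity_pow_self (by norm_num) (by decide),
      (emultiplicity_eq_zero.2 (by rintro ⟨t, ht⟩; exact Int.not_even_iff_odd.2 hsu ⟨t, by linarith [ht]⟩)), add_zero]
  have v2 : emultiplicity (2 : ℤ) (2 ^ b * (s' * u')) = b := by
    rw [emultiplicity_mul Int.prime_two, emultiplicity_pow_self (by norm_num) (by decide),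
      (emultiplicity_eq_zero.2 (by rintro ⟨t, ht⟩; exact Int.not_even_iff_odd.2 hsu' ⟨t, by linarith [ht]⟩)), add_zero]
  rw [key, v2] at v1
  exact hab (by exact_mod_cast v1.symm)

end Summit.Ventures.HSemireg.LineLawEvenWeights
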